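import Literature.Barriers.FinalStateConjecture.ExtremalHorizonInstabilityProofs
import Literature.Geometry.Lorentzian.KerrSchildWaveCauchyProblem
import HarnessLib

/-!
# Barrier catalogue `FinalStateConjecture`: the Cauchy problem behind the Aretakis instability —
# the chart-level Cauchy problem on extremal Kerr from the Cauchy problem on generalised
# Kerr–Schild backgrounds over `ℝ⁴` (`Literature/Barriers/FinalStateConjecture/`, D-0021, D-0014;
# family `gr`)

The discharge of the barrier `AretakisInstability` (`ExtremalHorizonInstability.lean`) needs a
smooth solution of `□_{g_{M,M}} ψ = 0` on the horizon-penetrating chart `Kerr.region M r₀`,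
`0 < r₀ < M`, of extremal Kerr with prescribed localised Cauchy data on the leaf `{t* = 0}` — the
global Cauchy problem with domain of dependence (Bär–Ginoux–Pfäffle 2007, Thm. 3.2.11, on the
Cauchy development of the leaf). This file **proves** that chart-level Cauchy problem,
`Kerr.extremal_waveCauchy_of_kerrSchild`, from the single chart-independent named fact
`KerrSchild.waveCauchyProblem` (`Literature/Geometry/Lorentzian/KerrSchildWaveCauchyProblem.lean`:
the Cauchy problem for the divergence-form wave operator of a generalised Kerr–Schild metric
`η + φ ℓ ⊗ ℓ` on all of `ℝ⁴` with bounded profile), through the metric surgery of that file: the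
extremal Kerr metric on `{r > r₀}` is extended inside `{r ≤ r₀}` to a smooth generalised
Kerr–Schild background on `ℝ⁴` (`Kerr.surgeryBackground M M r₀`), the background wave equation is
solved globally with the given data, and the solution is restricted to the chart, on the whole of
which it solves `□_{g_{M,M}} ψ = 0` (`Kerr.exists_wave_of_data`). In particular the open set `U` of
the statement can be taken to be the whole chart, and no analysis of the Cauchy development of the
leaf or of the causal character of the horizon is needed.

**Review of 2026-08-15 (D-0026/D-0027).** Until that review the chart-level statement was a
named fact of `ExtremalHorizonInstabilityProofs.lean` (`extremalKerr_waveCauchyProblem`), a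
decomposition child of the barrier; being the specialisation of the leaf fact
`KerrSchild.waveCauchyProblem` with a proved reduction, it was merged back: the statement is now
VERBATIM both the conclusion of the proved conditional theorem of this file and the hypothesis `hW`
of the reduction `AretakisInstability.of_facts` (`ExtremalHorizonInstabilityProofs.lean`), and
`AretakisInstability.of_kerrSchild hKS hA = AretakisInstability.of_facts
(Kerr.extremal_waveCauchy_of_kerrSchild hKS) hA` (`ExtremalHorizonInstabilityLeaves.lean`) consumes
the leaf fact directly; since the companion review-split of the second child (Aretakis's Thm. 3,
formerly the named fact `Aretakis2015_scalarInstability`, now a verbatim hypothesis `hA`) that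
composite is the theorem `AretakisInstability.of_waveCauchy` at the end of this file, of which
`AretakisInstability.of_kerrSchild` is a synonym. This file introduces no definition and no named
fact.

## References

* C. Bär, N. Ginoux, F. Pfäffle, *Wave equations on Lorentzian manifolds and quantization*, EMS 2007
  (arXiv:0806.1036), Thm. 3.2.11 (= arXiv Ch. 3, Sect. 2, Thm. 2.9), Cor. 3.2.4
  (key `BarGinouxPfaffle2007`).
* Y. Choquet-Bruhat, S. Cotsakis, *Global hyperbolicity and completeness*, J. Geom. Phys. 43
  (2002), Thm. 2.1 (key `ChoquetbruhatCotsakis2002`).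
* B. O'Neill, *Semi-Riemannian geometry*, Academic Press 1983, Ch. 14: Def. 35, Thm. 38, Lemma 43
  (key `ONeill1983`).
* M. Dafermos, I. Rodnianski, *Lectures on black holes and linear waves*, arXiv:0811.0354, §5.1
  (key `arXiv08110354`).
* S. Aretakis, Adv. Theor. Math. Phys. 19 (2015), §2.2, §5.2 and Thm. 3 (key `Aretakis2015`).
-/

noncomputable section

open Set
open scoped Manifold ContDiff

namespace Literature.Geometry.Lorentzian.Kerr

/-- **The Cauchy problem with domain of dependence for the wave equation on the extremal
Kerr–Schild chart (proved from `KerrSchild.waveCauchyProblem`).** Printed ingredients: (i) on a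
globally hyperbolic Lorentzian manifold with smooth spacelike Cauchy hypersurface `S` and future
unit normal `𝔫`, for all compactly supported smooth `u₀, u₁` on `S` there is a unique `u ∈ C^∞`
with `□u = 0`, `u|_S = u₀`, `∇_𝔫 u|_S = u₁`, and `supp u ⊆ J(supp u₀ ∪ supp u₁)`
(Bär–Ginoux–Pfäffle 2007, Thm. 3.2.11 = arXiv:0806.1036, Ch. 3, Sect. 2, Thm. 2.9; `□_g` is
normally hyperbolic); (ii) for a closed acausal topological hypersurface `S`, the Cauchy
development `D(S)` is open and globally hyperbolic (O'Neill 1983, Ch. 14, Def. 35, Thm. 38,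
Lemma 43), and `S` is a Cauchy hypersurface of it; (iii) in the ingoing Kerr–Schild chart with
`M ≥ 0` the leaves `{t* = τ}` are spacelike and `t*` increases strictly along future causal curves
(`−g♯dt*` is the time orientation, `Kerr.timeOrientation`), every causal vector `v` has
`|v⃗| ≤ |v⁰|` (`0 ≥ g(v, v) = η(v, v) + 2H ℓ(v)²`, `H ≥ 0`), and the future event horizon
`𝓗⁺ = {r = r₊}` is a null hypersurface crossed by future causal curves only inwards
(Dafermos–Rodnianski arXiv:0811.0354, §5.1; for extremal Kerr `𝓗⁺ = {r = M}`, Aretakis 2015,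
§5.2). Consequently, on the chart `Kerr.region M r₀` of extremal Kerr, `0 < r₀ < M`, the Cauchy
development `U = D(Σ₀)` of the leaf `Σ₀ = {t* = 0} ∩ {r > r₀}` is an open set containing `Σ₀` and
`{r ≥ M} ∩ {t* ≥ 0}`, and `J(K) ⊆ {x | ‖x⃗ − y‖ ≤ |t*(x)| for some y ∈ K}`.
**Statement (verbatim the hypothesis `hW` of `AretakisInstability.of_facts`,
`ExtremalHorizonInstabilityProofs.lean`).** For `M > 0`,
`0 < r₀ < M` and smooth `ψ₀, ψ₁ : E3 → ℝ` whose closed supports lie in the open slice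
`Kerr.slice M r₀ = {y | (0, y) ∈ Kerr.region M r₀}` and in the ball `{‖y‖ ≤ ρ}`, there are an open
set `U` of the chart containing the leaf `{t* = 0}` and `{r ≥ r₊ = M} ∩ {t* ≥ 0}`, and `ψ` of
class `C^∞` on `U` with `□_{g_{M,M}} ψ = 0` on `U` (`Kerr.smoothMetric M M r₀`,
`[Kerr.Facts] [Kerr.SliceFacts]` as in gr.S24), with Cauchy data `ψ(0, y) = ψ₀(y)` and
`∂_{t*}ψ(0, y) = ψ₁(y)` on the leaf (the coordinate derivative `∂_{t*} = N𝔫 + β`, `N > 0` the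
lapse, `β` tangent to the leaf, is prescribed through `u₁ = (ψ₁ − β(ψ₀))/N`, again smooth and
compactly supported in the slice), and with `ψ(x) = 0` at every `x ∈ U` with
`‖x⃗‖ > ρ + |t*(x)|`.
**Proof (from the leaf fact, replacing (ii)–(iii)).** The data are compactly supported, so
`Kerr.exists_wave_of_data` (Bär–Ginoux–Pfäffle 2007, Thm. 3.2.11, applied on the surgered
spacetime `(ℝ⁴, η + φ ℓ ⊗ ℓ)`, globally hyperbolic with Cauchy hypersurface `{t* = 0}` by
Choquet-Bruhat–Cotsakis 2002, Thm. 2.1) gives a `C^∞` solution on the WHOLE chart (`U = univ`)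
with the prescribed data, vanishing outside the coordinate cone hull of the support of the data;
for `y` in that support `‖y‖ ≤ ρ`, so `‖x⃗ − y‖ ≥ ‖x⃗‖ − ‖y‖ > |t*(x)|` on `{‖x⃗‖ > ρ + |t*|}`.
The subextremal exterior analogue of the last clause is `kerr_finite_speed_of_propagation`
(`KerrWaveEnergy.lean`).
[cite: BarGinouxPfaffle2007, Thm. 3.2.11 (arXiv Ch. 3 Sect. 2 Thm. 2.9); ChoquetbruhatCotsakis2002, Thm. 2.1; ONeill1983, Ch. 14 Def. 35, Thm. 38, Lemma 43; arXiv08110354, §5.1; Aretakis2015, §2.2 and §5.2] -/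
theorem extremal_waveCauchy_of_kerrSchild (h : KerrSchild.waveCauchyProblem) :
    ∀ [Kerr.Facts] [Kerr.SliceFacts] (M : ℝ), 0 < M → ∀ r₀ ∈ Set.Ioo 0 M,
      ∀ (ψ₀ ψ₁ : E3 → ℝ) (ρ : ℝ), ContDiff ℝ ∞ ψ₀ → ContDiff ℝ ∞ ψ₁ →
        tsupport ψ₀ ∪ tsupport ψ₁ ⊆ (Kerr.slice M r₀ : Set E3) ∩ Metric.closedBall 0 ρ →
        ∃ (U : Set (Kerr.region M r₀)) (ψ : Kerr.region M r₀ → ℝ),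
          IsOpen U ∧
          {x : Kerr.region M r₀ | (x : E4) 0 = 0} ⊆ U ∧
          {x : Kerr.region M r₀ | Kerr.rPlus M M ≤ Kerr.radius M (x : E4) ∧ 0 ≤ (x : E4) 0} ⊆ U ∧
          ContMDiffOn 𝓘(ℝ, E4) 𝓘(ℝ, ℝ) ∞ ψ U ∧
          (∀ x ∈ U, (Kerr.smoothMetric M M r₀).toPseudoRiemannianMetric.dalembertian ψ x = 0) ∧
          (∀ x : Kerr.region M r₀, (x : E4) 0 = 0 →
            ψ x = ψ₀ (E4.spatial (x : E4)) ∧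
              mfderiv 𝓘(ℝ, E4) 𝓘(ℝ, ℝ) ψ x (E4.basisVector 0) = ψ₁ (E4.spatial (x : E4))) ∧
          (∀ x ∈ U, ρ + |(x : E4) 0| < E4.spatialNorm (x : E4) → ψ x = 0) := by
  intro _ _ M hM r₀ hr₀ ψ₀ ψ₁ ρ hψ₀ hψ₁ hsupp
  obtain ⟨hr₀pos, -⟩ := hr₀
  -- the data are compactly supported
  have hK : IsCompact (Metric.closedBall (0 : E3) ρ) := isCompact_closedBall 0 ρ
  have hc₀ : HasCompactSupport ψ₀ :=
    hK.of_isClosed_subset (isClosed_tsupport ψ₀) fun y hy ↦ (hsupp (Or.inl hy)).2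
  have hc₁ : HasCompactSupport ψ₁ :=
    hK.of_isClosed_subset (isClosed_tsupport ψ₁) fun y hy ↦ (hsupp (Or.inr hy)).2
  -- solve on the whole chart
  obtain ⟨ψ, hψ, hsol, hdata, hzero⟩ :=
    Kerr.exists_wave_of_data h hM.le M hr₀pos hψ₀ hψ₁ hc₀ hc₁
  refine ⟨univ, ψ, isOpen_univ, subset_univ _, subset_univ _, hψ.contMDiffOn,
    fun x _ ↦ hsol x, hdata, fun x _ hx ↦ hzero x fun y hy ↦ ?_⟩
  -- the cone hull of the data lies in `{‖x⃗‖ ≤ ρ + |t*|}`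
  have hyρ : ‖y‖ ≤ ρ := by
    have := (hsupp hy).2
    rwa [Metric.mem_closedBall, dist_zero_right] at this
  have htri : E4.spatialNorm (x : E4) ≤ dist (E4.spatial (x : E4)) y + ‖y‖ := by
    rw [E4.spatialNorm, dist_eq_norm]
    exact norm_le_norm_sub_add _ _
  linarith

end Literature.Geometry.Lorentzian.Kerr

namespace Literature.Barriers.FinalStateConjecture

open Literature.Geometry.Lorentzian

/-- **The Aretakis barrier from the leaf Cauchy fact and Theorem 3 (proved composite).**
`AretakisInstability` follows from the Cauchy problem for generalised Kerr–Schild wave operators on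
`ℝ⁴` (`KerrSchild.waveCauchyProblem`, through `Kerr.extremal_waveCauchy_of_kerrSchild` above) and
Aretakis's Thm. 3, clauses `k = 1, 2`, in universal asymptotic form — hypothesis `hA`, spelled out
verbatim (it is stated and proved, modulo the decay leaf `Aretakis2012_pointwiseDecay`, downstream:
`Aretakis2015.scalarInstability_of_facts`, `ExtremalHorizonInstabilityAssembly.lean`, and
`Aretakis2015.scalarInstability_of_decay`, `ExtremalHorizonBlowupProofs.lean`) — by the reduction
`AretakisInstability.of_facts` of `ExtremalHorizonInstabilityProofs.lean`. This is the composite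
recorded as `AretakisInstability.of_kerrSchild` in `ExtremalHorizonInstabilityLeaves.lean`, placed
here, next to the Cauchy step it consumes, so that the files downstream of the statement of Thm. 3
refer to the reduction only through this name (review-split of 2026-08-15, D-0026/D-0027).
Aretakis, ATMP 19 (2015), Thm. 3; Bär–Ginoux–Pfäffle 2007, Thm. 3.2.11.
[cite: Aretakis2015, Thm. 3] -/
theorem AretakisInstability.of_waveCauchy (hKS : KerrSchild.waveCauchyProblem)
    (hA :
      ∀ [Kerr.Facts] [Kerr.SliceFacts] (M : ℝ), 0 < M → ∀ r₀ ∈ Set.Ioo 0 M,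
        ∃ c > (0 : ℝ), ∀ (U : Set (Kerr.region M r₀)) (ψ : Kerr.region M r₀ → ℝ),
          IsOpen U →
          {x : Kerr.region M r₀ | Kerr.rPlus M M ≤ Kerr.radius M (x : E4) ∧ 0 ≤ (x : E4) 0} ⊆ U →
          ContMDiffOn 𝓘(ℝ, E4) 𝓘(ℝ, ℝ) ∞ ψ U →
          (∀ x ∈ U, (Kerr.smoothMetric M M r₀).toPseudoRiemannianMetric.dalembertian ψ x = 0) →
          (∃ ρ : ℝ, ∀ x ∈ U, (x : E4) 0 = 0 → ρ < E4.spatialNorm (x : E4) →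
            ψ x = 0 ∧ mfderiv 𝓘(ℝ, E4) 𝓘(ℝ, ℝ) ψ x = 0) →
          aretakisCharge M r₀ ψ ≠ 0 →
          ∃ τ₁ : ℝ, ∀ τ : ℝ, τ₁ ≤ τ →
            (∃ x ∈ Kerr.horizonSection M M r₀ τ,
              c * |aretakisCharge M r₀ ψ| ≤ |Kerr.transversalDeriv M r₀ ψ x|) ∧
            (∃ x ∈ Kerr.horizonSection M M r₀ τ,
              c * |aretakisCharge M r₀ ψ| * τ ≤
                |Kerr.transversalDeriv M r₀ (Kerr.transversalDeriv M r₀ ψ) x|)) :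
    AretakisInstability :=
  AretakisInstability.of_facts (Kerr.extremal_waveCauchy_of_kerrSchild hKS) hA

end Literature.Barriers.FinalStateConjecture

end
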